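import Summits.HodgeConjecture.HodgeConjecture.Theorems.H413HolThetaAtAdmissibleLine
import HarnessLib

/-!
# FLOOR-0 P4, S4b — THE FOLD of the closer into the LETTER of `StubT3aHolThetaAtAdmissibleLineOfRallisAt`, generic in the antecedent

Cell hodgecm-mathlib (D-0151), FLOOR 0, crux item H413 = stmt-HodgeConjecture-24833; P4 line `Cruxes/H413/Lines/F0_P4AdmissibleOccursInH1.lean` (tree ED. 3.2;
ED. 3.3 swaps the antecedent `Li1992.…RankOneCont ↦ …RankOneContCM`), stub S4b `stub_T3a_holThetaAtAdmissibleLineOfRallisAt`.  Author F0P4-p01 (g2) (S4b closer).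
`--supports stmt-HodgeConjecture-24833 --as helper`.  DEF-FREE: one theorem; nothing is cited as a fact, no `sorry`.

**`holThetaAtAdmissibleLine_fold`** — for ANY antecedent `R : Prop` and any producer
`chiN : R → ∀ (hDel F [IsGalois ℚ F] h6 ι₁ V a₀ Φ i t hw hι e a he hae), hχN` (the hypothesis of ★ `exists_holTheta_admissibleLine_of_chiN` VERBATIM;
F0P4-p05 (g2)'s `chiN_of_rankOneContCM` at `R := Li1992.RallisInnerProductFormulaUnitaryDualPairRankOneContCM`), the statement
`R → <body of StubT3aHolThetaAtAdmissibleLineOfRallisAt after its antecedent, tree ED. 3.2 ll. 494–537 VERBATIM>`.  So the by-name fold of the line is the term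
`holThetaAtAdmissibleLine_fold chiN_of_rankOneContCM` (ED. 3.3 letter) — or `… (fun hR => chiN_of_… (bridge hR))` under any later re-lettering of S6.
The unused letter binders (`hΦ`, `n = 3`, `t.IsAdmissible`, `locF a = t.ε`) are discarded here, once.
HC_CM is proved only modulo the printed citations until rung 0 closes; this file proves nothing about them.

## References
* [Liu2021] Y. Liu, Camb. J. Math. 9 (2021) = arXiv:2102.11518: proof of Prop. 4.13 (l. 2145); Def. 4.11–4.12; App. D Lem. D.2.
* Tree: ★ `Theorems/H413HolThetaAtAdmissibleLine` (`exists_holTheta_admissibleLine_of_chiN`), `Cruxes/H413/Lines/F0_P4AdmissibleOccursInH1.lean` (the letter; NOT imported).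
-/

set_option autoImplicit false
set_option linter.dupNamespace false

noncomputable section

open MulAction NumberField NumberField.InfinitePlace NumberField.mixedEmbedding IsDedekindDomain
open scoped SchwartzMap TensorProduct Classical Matrix
open Literature.NumberTheory.Automorphic Literature.NumberTheory.Automorphic.UnitaryGroup Literature.NumberTheory.Weil1964
open Literature.Geometry.ComplexHyperbolic.BallModel (U21 x₀)
open Literature.AlgebraicGeometry.ShimuraVarieties
open Literature.AlgebraicGeometry.Motives (CMType)
open Literature.NumberTheory.GelbartRogawski1991 Literature.NumberTheory.GelbartRogawski1991.UnitaryDualPair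
open Literature.NumberTheory.GelbartRogawski1991.UnitaryDualPair.WeilCoinv (commute_comp_inl_comp_inr finPairToAdelic finPairRep)
open Literature.NumberTheory.Automorphic.Liu2021
open Literature.NumberTheory.Automorphic.Liu2021.Def411WeilCarriers (omegaAtLine rhoVAtLine Chi TW JW JW_eq isSymm_TW isUnit_det_TW lineChar locF)
open Literature.NumberTheory.Automorphic.Liu2021.Def411WeilCarriersDoubling
open Literature.NumberTheory.GaloisRepresentations (HeckeCharacter)
open Literature.RepresentationTheory.HarrisKudlaSweet1996 (IsSplittingChar)
open HodgeCM HodgeCM.Adelic HodgeCM.PerL34 HodgeCM.Model HodgeCM.Model.ThetaSpace HodgeCM.Model.ArchSideTerm HodgeCM.Model.ThetaAdelicSide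
open HodgeCM.Model.ThetaDistFin HodgeCM.Model.HypCensus HodgeCM.Model.LiuIndex HodgeCM.Model.TowerCarrier
open HodgeCM.Model.SupplyResidual.WeilPairData (charInv)
open Literature.Analysis.SegalBargmann (binvPi)
open Literature.AlgebraicGeometry.ShimuraVarieties (BallForms.isPullbackCocycle_cotangentCocycle BallForms.expP)
open Literature.AlgebraicGeometry.Liu2021 (IsAdmissibleElement)
open Summit.HodgeConjecture.CorCM Summit.HodgeConjecture.CorCM.Model Summit.HodgeConjecture.CorCM.Transposition
open Summit.HodgeConjecture.CorCM.Transposition.OmegaChiSplitting (hsChiD)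
open Summit.HodgeConjecture.CorCM.Transposition.CentralTypeAtPin (hasCentralTypeAt_chiSplittingLine_toHeckeCharacter)
open Summit.HodgeConjecture.CorCM.Lines.A3Liu413 (datum413)
open Summit.HodgeConjecture.HodgeConjecture.Cruxes.H413.CohFormsCarriers
open Summit.HodgeConjecture.HodgeConjecture.Cruxes.H413.CuspCot
open Summit.HodgeConjecture.HodgeConjecture.Cruxes.H413.ThetaDistAtLine
open Summit.HodgeConjecture.HodgeConjecture.Cruxes.H413.AdmissibleLine
open Summit.HodgeConjecture.HodgeConjecture.Cruxes.H413.IndexOrientation (embedding_mk_eq_of_indexOfRecord)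

namespace Summit.HodgeConjecture.HodgeConjecture.Cruxes.H413.ThetaJunction

set_option synthInstance.maxHeartbeats 400000 in
set_option maxHeartbeats 8000000 in
/-- **THE FOLD**: for ANY antecedent `R` (ED. 3.2: `…RankOneCont`; ED. 3.3: `…RankOneContCM`) and a producer `chiN : R → (binders) → hχN`, the body of
`StubT3aHolThetaAtAdmissibleLineOfRallisAt` with antecedent `R`. [cite: Liu2021, proof of Prop. 4.13 (l. 2145)] -/
theorem holThetaAtAdmissibleLine_fold {R : Prop}
    (chiN : R → ∀ (hDel : Literature.AlgebraicGeometry.ShimuraVarieties.UnitaryCanonicalModel.canonicalModel_exists_printed)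
      (F : HodgeCM.CMField) [IsGalois ℚ F] (h6 : 6 ≤ Module.finrank ℚ F) {ι₁ : F →+* ℂ} (V : HodgeCM.HermSpace3 F ι₁) (a₀ : RealScalar F)
      (Φ : CMType F) (i : (I V (repAt a₀) (muLiu ι₁ GramClass.rep)))
      (t : (datum413 hDel F V a₀ Φ i).Triple) (hw : t.HasWeightOne) (hι : ι₁ ∈ t.cmType.1)
      (e : HodgeCM.CMField.K F) (a : (↥(maximalRealSubfield (HodgeCM.CMField.K F)))ˣ)
      (he : Literature.AlgebraicGeometry.Liu2021.IsAdmissibleElement (HodgeCM.CMField.K F) t.cmType.1 e)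
      (hae : ((a : ↥(maximalRealSubfield (HodgeCM.CMField.K F))) : HodgeCM.CMField.K F) = e * (2 * imagUnit (HodgeCM.CMField.K F))),
      ∀ (hV : IsAnisotropic F (HodgeCM.HermSpace3.Hm V)) (ha : IsCMField.complexConj (HodgeCM.CMField.K F) ((a : ↥(maximalRealSubfield (HodgeCM.CMField.K F))) : (HodgeCM.CMField.K F)) = ((a : ↥(maximalRealSubfield (HodgeCM.CMField.K F))) : (HodgeCM.CMField.K F))) (ha0 : ((a : ↥(maximalRealSubfield (HodgeCM.CMField.K F))) :
        (HodgeCM.CMField.K F)) ≠ 0)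
      (hpos : 0 < cmXW (HodgeCM.CMField.K F) (frameD V) (lineVec (HodgeCM.CMField.K F) (dW (cDiag Φ ι₁ ((a : ↥(maximalRealSubfield (HodgeCM.CMField.K F))) : (HodgeCM.CMField.K F)) ha ha0).D 0)) (fun _ => dW_real (cDiag Φ ι₁ ((a : ↥(maximalRealSubfield (HodgeCM.CMField.K F))) : (HodgeCM.CMField.K F)) ha ha0).D 0) ι₁ (cmPlace
          (HodgeCM.CMField.K F) ι₁) 0)
      (ĉ : UnitaryGroup.adelicPair (↥(maximalRealSubfield (HodgeCM.CMField.K F))) (HodgeCM.CMField.K F) (IsCMField.complexConj (HodgeCM.CMField.K F)) 3 1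
        (Matrix.diagonal (frameD V)) (Matrix.diagonal (lineVec (HodgeCM.CMField.K F) ((a : ↥(maximalRealSubfield (HodgeCM.CMField.K F))) : (HodgeCM.CMField.K F)))) →* ℂˣ),
      (chiSplitting (HodgeCM.CMField.K F) e₁ (frameD V) (frameD_real V) (frameD_ne V) (lineVec (HodgeCM.CMField.K F) ((a : ↥(maximalRealSubfield (HodgeCM.CMField.K F))) : (HodgeCM.CMField.K F))) (complexConj_lineVec_coe (HodgeCM.CMField.K F) a) (lineVec_coe_ne_zero (HodgeCM.CMField.K F) a)
          (Literature.NumberTheory.Automorphic.IdeleClassGroup.toHeckeCharacter (HodgeCM.CMField.K F) t.μ) (Literature.NumberTheory.Automorphic.IdeleClassGroup.isUnitary_toHeckeCharacter (HodgeCM.CMField.K F) t.μ) ((Literature.RepresentationTheory.Liu2021.isOscillatorChar_toHeckeCharacter_iff t.μ).mpr t.isConjugateSymplectic)) =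
        adelicMpCont.twist (↥(maximalRealSubfield (HodgeCM.CMField.K F))) (Fin 3) _ (splittingOf _ _ _ _ _ _ _ _ _ _ _ _ _ _ _ _ _ (compat_line₀ V Φ ι₁ ((a : ↥(maximalRealSubfield (HodgeCM.CMField.K F))) : (HodgeCM.CMField.K F)) ha ha0)) ĉ →
      (∀ γU ∈ (UnitaryGroup.toAdelic (↥(maximalRealSubfield (HodgeCM.CMField.K F))) (HodgeCM.CMField.K F) (IsCMField.complexConj (HodgeCM.CMField.K F)) 3 (Matrix.diagonal (frameD V))).range, ĉ ((UnitaryGroup.adelicInl (↥(maximalRealSubfield (HodgeCM.CMField.K F))) (HodgeCM.CMField.K F) (IsCMField.complexConj (HodgeCM.CMField.K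
          F)) 3 1 (Matrix.diagonal (frameD V)) (Matrix.diagonal (lineVec (HodgeCM.CMField.K F) ((a : ↥(maximalRealSubfield (HodgeCM.CMField.K F))) : (HodgeCM.CMField.K F))))) γU) = 1) →
      (∀ γ ∈ (UnitaryGroup.toAdelic (↥(maximalRealSubfield (HodgeCM.CMField.K F))) (HodgeCM.CMField.K F) (IsCMField.complexConj (HodgeCM.CMField.K F)) 1 (Matrix.diagonal (lineVec (HodgeCM.CMField.K F) ((a : ↥(maximalRealSubfield (HodgeCM.CMField.K F))) : (HodgeCM.CMField.K F))))).range, ĉ ((UnitaryGroup.adelicInr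
          (↥(maximalRealSubfield (HodgeCM.CMField.K F))) (HodgeCM.CMField.K F) (IsCMField.complexConj (HodgeCM.CMField.K F)) 3 1 (Matrix.diagonal (frameD V)) (Matrix.diagonal (lineVec (HodgeCM.CMField.K F) ((a : ↥(maximalRealSubfield (HodgeCM.CMField.K F))) : (HodgeCM.CMField.K F))))) γ) = 1) →
      Continuous ĉ →
      ∀ (hν : ∀ γU ∈ CMRat (HodgeCM.CMField.K F) (frameD V), ((cmLineChar₀ (HodgeCM.CMField.K F) finProdFinEquiv e₁ (frameD V) (frameD_real V) (frameD_ne V) (dW (cDiag Φ ι₁ ((a : ↥(maximalRealSubfield (HodgeCM.CMField.K F))) : (HodgeCM.CMField.K F)) ha ha0).D) (dW_real (cDiag Φ ι₁ ((a : ↥(maximalRealSubfield (HodgeCM.CMField.K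
          F))) : (HodgeCM.CMField.K F)) ha ha0).D) (dW_ne (cDiag Φ ι₁ ((a : ↥(maximalRealSubfield (HodgeCM.CMField.K F))) : (HodgeCM.CMField.K F)) ha ha0).D) (compat_plane V Φ ι₁ ((a : ↥(maximalRealSubfield (HodgeCM.CMField.K F))) : (HodgeCM.CMField.K F)) ha ha0) (compat_line₀ V Φ ι₁ ((a : ↥(maximalRealSubfield
          (HodgeCM.CMField.K F))) : (HodgeCM.CMField.K F)) ha ha0) (compat_line₁ V Φ ι₁ ((a : ↥(maximalRealSubfield (HodgeCM.CMField.K F))) : (HodgeCM.CMField.K F)) ha ha0)).comp (MonoidHom.inl _ _) * (ĉ.comp (UnitaryGroup.adelicInl (↥(maximalRealSubfield (HodgeCM.CMField.K F))) (HodgeCM.CMField.K F) (IsCMField.complexConj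
          (HodgeCM.CMField.K F)) 3 1 (Matrix.diagonal (frameD V)) (Matrix.diagonal (lineVec (HodgeCM.CMField.K F) ((a : ↥(maximalRealSubfield (HodgeCM.CMField.K F))) : (HodgeCM.CMField.K F))))))⁻¹) γU = 1)
        (hνc : Continuous fun v => ((((cmLineChar₀ (HodgeCM.CMField.K F) finProdFinEquiv e₁ (frameD V) (frameD_real V) (frameD_ne V) (dW (cDiag Φ ι₁ ((a : ↥(maximalRealSubfield (HodgeCM.CMField.K F))) : (HodgeCM.CMField.K F)) ha ha0).D) (dW_real (cDiag Φ ι₁ ((a : ↥(maximalRealSubfield (HodgeCM.CMField.K F))) :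
            (HodgeCM.CMField.K F)) ha ha0).D) (dW_ne (cDiag Φ ι₁ ((a : ↥(maximalRealSubfield (HodgeCM.CMField.K F))) : (HodgeCM.CMField.K F)) ha ha0).D) (compat_plane V Φ ι₁ ((a : ↥(maximalRealSubfield (HodgeCM.CMField.K F))) : (HodgeCM.CMField.K F)) ha ha0) (compat_line₀ V Φ ι₁ ((a : ↥(maximalRealSubfield (HodgeCM.CMField.K
            F))) : (HodgeCM.CMField.K F)) ha ha0) (compat_line₁ V Φ ι₁ ((a : ↥(maximalRealSubfield (HodgeCM.CMField.K F))) : (HodgeCM.CMField.K F)) ha ha0)).comp (MonoidHom.inl _ _) * (ĉ.comp (UnitaryGroup.adelicInl (↥(maximalRealSubfield (HodgeCM.CMField.K F))) (HodgeCM.CMField.K F) (IsCMField.complexConj (HodgeCM.CMField.K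
            F)) 3 1 (Matrix.diagonal (frameD V)) (Matrix.diagonal (lineVec (HodgeCM.CMField.K F) ((a : ↥(maximalRealSubfield (HodgeCM.CMField.K F))) : (HodgeCM.CMField.K F))))))⁻¹) v : ℂˣ) : ℂ))
        (A : ∀ k : Fin 4, ArchLineInput V (lineRepT V (cDiag Φ ι₁ ((a : ↥(maximalRealSubfield (HodgeCM.CMField.K F))) : (HodgeCM.CMField.K F)) ha ha0).D (compat_plane V Φ ι₁ ((a : ↥(maximalRealSubfield (HodgeCM.CMField.K F))) : (HodgeCM.CMField.K F)) ha ha0) (compat_line₀ V Φ ι₁ ((a : ↥(maximalRealSubfield (HodgeCM.CMField.K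
            F))) : (HodgeCM.CMField.K F)) ha ha0) (compat_line₁ V Φ ι₁ ((a : ↥(maximalRealSubfield (HodgeCM.CMField.K F))) : (HodgeCM.CMField.K F)) ha ha0) (compat_line₂ V Φ ι₁ ((a : ↥(maximalRealSubfield (HodgeCM.CMField.K F))) : (HodgeCM.CMField.K F)) ha ha0) (compat_line₃ V Φ ι₁ ((a : ↥(maximalRealSubfield (HodgeCM.CMField.K
            F))) : (HodgeCM.CMField.K F)) ha ha0) (1 : CMAdelic (HodgeCM.CMField.K F) (frameD V) × CMAdelic (HodgeCM.CMField.K F) (dW (cDiag Φ ι₁ ((a : ↥(maximalRealSubfield (HodgeCM.CMField.K F))) : (HodgeCM.CMField.K F)) ha ha0).D) →* ℂˣ) ((cmLineChar₀ (HodgeCM.CMField.K F) finProdFinEquiv e₁ (frameD V) (frameD_real V)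
            (frameD_ne V) (dW (cDiag Φ ι₁ ((a : ↥(maximalRealSubfield (HodgeCM.CMField.K F))) : (HodgeCM.CMField.K F)) ha ha0).D) (dW_real (cDiag Φ ι₁ ((a : ↥(maximalRealSubfield (HodgeCM.CMField.K F))) : (HodgeCM.CMField.K F)) ha ha0).D) (dW_ne (cDiag Φ ι₁ ((a : ↥(maximalRealSubfield (HodgeCM.CMField.K F))) :
            (HodgeCM.CMField.K F)) ha ha0).D) (compat_plane V Φ ι₁ ((a : ↥(maximalRealSubfield (HodgeCM.CMField.K F))) : (HodgeCM.CMField.K F)) ha ha0) (compat_line₀ V Φ ι₁ ((a : ↥(maximalRealSubfield (HodgeCM.CMField.K F))) : (HodgeCM.CMField.K F)) ha ha0) (compat_line₁ V Φ ι₁ ((a : ↥(maximalRealSubfield (HodgeCM.CMField.K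
            F))) : (HodgeCM.CMField.K F)) ha ha0)).comp (MonoidHom.inl _ _) * (ĉ.comp (UnitaryGroup.adelicInl (↥(maximalRealSubfield (HodgeCM.CMField.K F))) (HodgeCM.CMField.K F) (IsCMField.complexConj (HodgeCM.CMField.K F)) 3 1 (Matrix.diagonal (frameD V)) (Matrix.diagonal (lineVec (HodgeCM.CMField.K F) ((a :
            ↥(maximalRealSubfield (HodgeCM.CMField.K F))) : (HodgeCM.CMField.K F))))))⁻¹) k))
        (harm : ∀ (u : ↥(stabilizer U21 x₀)) (ℓ : Module.Dual ℂ (Fin 2 → ℂ)),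
          lineOmega_zero V (cDiag Φ ι₁ ((a : ↥(maximalRealSubfield (HodgeCM.CMField.K F))) : (HodgeCM.CMField.K F)) ha ha0).D (compat_plane V Φ ι₁ ((a : ↥(maximalRealSubfield (HodgeCM.CMField.K F))) : (HodgeCM.CMField.K F)) ha ha0) (compat_line₀ V Φ ι₁ ((a : ↥(maximalRealSubfield (HodgeCM.CMField.K F))) : (HodgeCM.CMField.K F))
              ha ha0) (compat_line₁ V Φ ι₁ ((a : ↥(maximalRealSubfield (HodgeCM.CMField.K F))) : (HodgeCM.CMField.K F)) ha ha0) (etaT₀ V (cDiag Φ ι₁ ((a : ↥(maximalRealSubfield (HodgeCM.CMField.K F))) : (HodgeCM.CMField.K F)) ha ha0).D (1 : CMAdelic (HodgeCM.CMField.K F) (frameD V) × CMAdelic (HodgeCM.CMField.K F) (dW (cDiag Φ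
              ι₁ ((a : ↥(maximalRealSubfield (HodgeCM.CMField.K F))) : (HodgeCM.CMField.K F)) ha ha0).D) →* ℂˣ) ((cmLineChar₀ (HodgeCM.CMField.K F) finProdFinEquiv e₁ (frameD V) (frameD_real V) (frameD_ne V) (dW (cDiag Φ ι₁ ((a : ↥(maximalRealSubfield (HodgeCM.CMField.K F))) : (HodgeCM.CMField.K F)) ha ha0).D) (dW_real (cDiag Φ
              ι₁ ((a : ↥(maximalRealSubfield (HodgeCM.CMField.K F))) : (HodgeCM.CMField.K F)) ha ha0).D) (dW_ne (cDiag Φ ι₁ ((a : ↥(maximalRealSubfield (HodgeCM.CMField.K F))) : (HodgeCM.CMField.K F)) ha ha0).D) (compat_plane V Φ ι₁ ((a : ↥(maximalRealSubfield (HodgeCM.CMField.K F))) : (HodgeCM.CMField.K F)) ha ha0)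
              (compat_line₀ V Φ ι₁ ((a : ↥(maximalRealSubfield (HodgeCM.CMField.K F))) : (HodgeCM.CMField.K F)) ha ha0) (compat_line₁ V Φ ι₁ ((a : ↥(maximalRealSubfield (HodgeCM.CMField.K F))) : (HodgeCM.CMField.K F)) ha ha0)).comp (MonoidHom.inl _ _) * (ĉ.comp (UnitaryGroup.adelicInl (↥(maximalRealSubfield (HodgeCM.CMField.K
              F))) (HodgeCM.CMField.K F) (IsCMField.complexConj (HodgeCM.CMField.K F)) 3 1 (Matrix.diagonal (frameD V)) (Matrix.diagonal (lineVec (HodgeCM.CMField.K F) ((a : ↥(maximalRealSubfield (HodgeCM.CMField.K F))) : (HodgeCM.CMField.K F))))))⁻¹)) (u : U21) ((blockFamilyOfAt (HodgeCM.CMField.K F) e₁ (frameD V) (frameD_real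
              V) (frameD_ne V) (lineVec (HodgeCM.CMField.K F) (dW (cDiag Φ ι₁ ((a : ↥(maximalRealSubfield (HodgeCM.CMField.K F))) : (HodgeCM.CMField.K F)) ha ha0).D 0)) (fun _ => dW_real (cDiag Φ ι₁ ((a : ↥(maximalRealSubfield (HodgeCM.CMField.K F))) : (HodgeCM.CMField.K F)) ha ha0).D 0) (fun _ => dW_ne (cDiag Φ ι₁ ((a :
              ↥(maximalRealSubfield (HodgeCM.CMField.K F))) : (HodgeCM.CMField.K F)) ha ha0).D 0) ι₁ (blockPosEquiv V) (blockNegEquiv V) (posIdxEquivUnit hpos) (negIdxEquivEmpty hpos) (degOnePDual Empty) (binvPi 1)) ℓ) =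
            (blockFamilyOfAt (HodgeCM.CMField.K F) e₁ (frameD V) (frameD_real V) (frameD_ne V) (lineVec (HodgeCM.CMField.K F) (dW (cDiag Φ ι₁ ((a : ↥(maximalRealSubfield (HodgeCM.CMField.K F))) : (HodgeCM.CMField.K F)) ha ha0).D 0)) (fun _ => dW_real (cDiag Φ ι₁ ((a : ↥(maximalRealSubfield (HodgeCM.CMField.K F))) :
                (HodgeCM.CMField.K F)) ha ha0).D 0) (fun _ => dW_ne (cDiag Φ ι₁ ((a : ↥(maximalRealSubfield (HodgeCM.CMField.K F))) : (HodgeCM.CMField.K F)) ha ha0).D 0) ι₁ (blockPosEquiv V) (blockNegEquiv V) (posIdxEquivUnit hpos) (negIdxEquivEmpty hpos) (degOnePDual Empty) (binvPi 1))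
                ((BallForms.isPullbackCocycle_cotangentCocycle.weightOf x₀).dual u ℓ))
        (hdef : ∀ g : UnitaryGroup.arch (↥(maximalRealSubfield (HodgeCM.CMField.K F))) (HodgeCM.CMField.K F) (IsCMField.complexConj (HodgeCM.CMField.K F)) 3 V.Hm,
          UnitaryGroup.archAt (↥(maximalRealSubfield (HodgeCM.CMField.K F))) (HodgeCM.CMField.K F) (IsCMField.complexConj (HodgeCM.CMField.K F)) 3 V.Hm (UnitaryGroup.cmPlace (HodgeCM.CMField.K F) ι₁) (NumberField.complexConj_smul_infinitePlace (HodgeCM.CMField.K F) _) (IsCMField.complexConj_ne_one (HodgeCM.CMField.K F)) g = 1 →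
          ∀ (ℓ : Module.Dual ℂ (Fin 2 → ℂ)) (Φf : FinSB (↥(maximalRealSubfield (HodgeCM.CMField.K F))) (Fin 3)),
            lineRepOf V (cDiag Φ ι₁ ((a : ↥(maximalRealSubfield (HodgeCM.CMField.K F))) : (HodgeCM.CMField.K F)) ha ha0).D (compat_plane V Φ ι₁ ((a : ↥(maximalRealSubfield (HodgeCM.CMField.K F))) : (HodgeCM.CMField.K F)) ha ha0) (compat_line₀ V Φ ι₁ ((a : ↥(maximalRealSubfield (HodgeCM.CMField.K F))) : (HodgeCM.CMField.K F)) ha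
                ha0) (compat_line₁ V Φ ι₁ ((a : ↥(maximalRealSubfield (HodgeCM.CMField.K F))) : (HodgeCM.CMField.K F)) ha ha0) (compat_line₂ V Φ ι₁ ((a : ↥(maximalRealSubfield (HodgeCM.CMField.K F))) : (HodgeCM.CMField.K F)) ha ha0) (compat_line₃ V Φ ι₁ ((a : ↥(maximalRealSubfield (HodgeCM.CMField.K F))) : (HodgeCM.CMField.K
                F)) ha ha0) (etaT₀ V (cDiag Φ ι₁ ((a : ↥(maximalRealSubfield (HodgeCM.CMField.K F))) : (HodgeCM.CMField.K F)) ha ha0).D (1 : CMAdelic (HodgeCM.CMField.K F) (frameD V) × CMAdelic (HodgeCM.CMField.K F) (dW (cDiag Φ ι₁ ((a : ↥(maximalRealSubfield (HodgeCM.CMField.K F))) : (HodgeCM.CMField.K F)) ha ha0).D) →* ℂˣ)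
                ((cmLineChar₀ (HodgeCM.CMField.K F) finProdFinEquiv e₁ (frameD V) (frameD_real V) (frameD_ne V) (dW (cDiag Φ ι₁ ((a : ↥(maximalRealSubfield (HodgeCM.CMField.K F))) : (HodgeCM.CMField.K F)) ha ha0).D) (dW_real (cDiag Φ ι₁ ((a : ↥(maximalRealSubfield (HodgeCM.CMField.K F))) : (HodgeCM.CMField.K F)) ha ha0).D)
                (dW_ne (cDiag Φ ι₁ ((a : ↥(maximalRealSubfield (HodgeCM.CMField.K F))) : (HodgeCM.CMField.K F)) ha ha0).D) (compat_plane V Φ ι₁ ((a : ↥(maximalRealSubfield (HodgeCM.CMField.K F))) : (HodgeCM.CMField.K F)) ha ha0) (compat_line₀ V Φ ι₁ ((a : ↥(maximalRealSubfield (HodgeCM.CMField.K F))) : (HodgeCM.CMField.K F)) ha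
                ha0) (compat_line₁ V Φ ι₁ ((a : ↥(maximalRealSubfield (HodgeCM.CMField.K F))) : (HodgeCM.CMField.K F)) ha ha0)).comp (MonoidHom.inl _ _) * (ĉ.comp (UnitaryGroup.adelicInl (↥(maximalRealSubfield (HodgeCM.CMField.K F))) (HodgeCM.CMField.K F) (IsCMField.complexConj (HodgeCM.CMField.K F)) 3 1 (Matrix.diagonal
                (frameD V)) (Matrix.diagonal (lineVec (HodgeCM.CMField.K F) ((a : ↥(maximalRealSubfield (HodgeCM.CMField.K F))) : (HodgeCM.CMField.K F))))))⁻¹))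
                (etaT₁ V (cDiag Φ ι₁ ((a : ↥(maximalRealSubfield (HodgeCM.CMField.K F))) : (HodgeCM.CMField.K F)) ha ha0).D (1 : CMAdelic (HodgeCM.CMField.K F) (frameD V) × CMAdelic (HodgeCM.CMField.K F) (dW (cDiag Φ ι₁ ((a : ↥(maximalRealSubfield (HodgeCM.CMField.K F))) : (HodgeCM.CMField.K F)) ha ha0).D) →* ℂˣ) ((cmLineChar₀
                    (HodgeCM.CMField.K F) finProdFinEquiv e₁ (frameD V) (frameD_real V) (frameD_ne V) (dW (cDiag Φ ι₁ ((a : ↥(maximalRealSubfield (HodgeCM.CMField.K F))) : (HodgeCM.CMField.K F)) ha ha0).D) (dW_real (cDiag Φ ι₁ ((a : ↥(maximalRealSubfield (HodgeCM.CMField.K F))) : (HodgeCM.CMField.K F)) ha ha0).D) (dW_ne (cDiag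
                    Φ ι₁ ((a : ↥(maximalRealSubfield (HodgeCM.CMField.K F))) : (HodgeCM.CMField.K F)) ha ha0).D) (compat_plane V Φ ι₁ ((a : ↥(maximalRealSubfield (HodgeCM.CMField.K F))) : (HodgeCM.CMField.K F)) ha ha0) (compat_line₀ V Φ ι₁ ((a : ↥(maximalRealSubfield (HodgeCM.CMField.K F))) : (HodgeCM.CMField.K F)) ha ha0)
                    (compat_line₁ V Φ ι₁ ((a : ↥(maximalRealSubfield (HodgeCM.CMField.K F))) : (HodgeCM.CMField.K F)) ha ha0)).comp (MonoidHom.inl _ _) * (ĉ.comp (UnitaryGroup.adelicInl (↥(maximalRealSubfield (HodgeCM.CMField.K F))) (HodgeCM.CMField.K F) (IsCMField.complexConj (HodgeCM.CMField.K F)) 3 1 (Matrix.diagonal (frameD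
                    V)) (Matrix.diagonal (lineVec (HodgeCM.CMField.K F) ((a : ↥(maximalRealSubfield (HodgeCM.CMField.K F))) : (HodgeCM.CMField.K F))))))⁻¹)) (eta₂ V (cDiag Φ ι₁ ((a : ↥(maximalRealSubfield (HodgeCM.CMField.K F))) : (HodgeCM.CMField.K F)) ha ha0).D (1 : CMAdelic (HodgeCM.CMField.K F) (frameD V) × CMAdelic
                    (HodgeCM.CMField.K F) (dW (cDiag Φ ι₁ ((a : ↥(maximalRealSubfield (HodgeCM.CMField.K F))) : (HodgeCM.CMField.K F)) ha ha0).D) →* ℂˣ)) (eta₃ V (cDiag Φ ι₁ ((a : ↥(maximalRealSubfield (HodgeCM.CMField.K F))) : (HodgeCM.CMField.K F)) ha ha0).D (1 : CMAdelic (HodgeCM.CMField.K F) (frameD V) × CMAdelic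
                    (HodgeCM.CMField.K F) (dW (cDiag Φ ι₁ ((a : ↥(maximalRealSubfield (HodgeCM.CMField.K F))) : (HodgeCM.CMField.K F)) ha ha0).D) →* ℂˣ)) 0
                (HodgeCM.Adelic.regimeEquiv F V.Hm hV (UnitaryGroup.archToAdelic (↥(maximalRealSubfield (HodgeCM.CMField.K F))) (HodgeCM.CMField.K F) (IsCMField.complexConj (HodgeCM.CMField.K F)) 3 V.Hm g), 1)
                (piSchwartzBruhatEquiv (↥(maximalRealSubfield (HodgeCM.CMField.K F))) (Fin 3) ((blockFamilyOfAt (HodgeCM.CMField.K F) e₁ (frameD V) (frameD_real V) (frameD_ne V) (lineVec (HodgeCM.CMField.K F) (dW (cDiag Φ ι₁ ((a : ↥(maximalRealSubfield (HodgeCM.CMField.K F))) : (HodgeCM.CMField.K F)) ha ha0).D 0)) (fun _ =>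
                    dW_real (cDiag Φ ι₁ ((a : ↥(maximalRealSubfield (HodgeCM.CMField.K F))) : (HodgeCM.CMField.K F)) ha ha0).D 0) (fun _ => dW_ne (cDiag Φ ι₁ ((a : ↥(maximalRealSubfield (HodgeCM.CMField.K F))) : (HodgeCM.CMField.K F)) ha ha0).D 0) ι₁ (blockPosEquiv V) (blockNegEquiv V) (posIdxEquivUnit hpos) (negIdxEquivEmpty
                    hpos) (degOnePDual Empty) (binvPi 1)) ℓ ⊗ₜ[ℂ] Φf)) =
              piSchwartzBruhatEquiv (↥(maximalRealSubfield (HodgeCM.CMField.K F))) (Fin 3) ((blockFamilyOfAt (HodgeCM.CMField.K F) e₁ (frameD V) (frameD_real V) (frameD_ne V) (lineVec (HodgeCM.CMField.K F) (dW (cDiag Φ ι₁ ((a : ↥(maximalRealSubfield (HodgeCM.CMField.K F))) : (HodgeCM.CMField.K F)) ha ha0).D 0)) (fun _ =>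
                  dW_real (cDiag Φ ι₁ ((a : ↥(maximalRealSubfield (HodgeCM.CMField.K F))) : (HodgeCM.CMField.K F)) ha ha0).D 0) (fun _ => dW_ne (cDiag Φ ι₁ ((a : ↥(maximalRealSubfield (HodgeCM.CMField.K F))) : (HodgeCM.CMField.K F)) ha ha0).D 0) ι₁ (blockPosEquiv V) (blockNegEquiv V) (posIdxEquivUnit hpos) (negIdxEquivEmpty
                  hpos) (degOnePDual Empty) (binvPi 1)) ℓ ⊗ₜ[ℂ] Φf)),
      ∃ χM : PontryaginDual (↥(Literature.NumberTheory.Automorphic.relNormOneIdeles (↥(maximalRealSubfield (HodgeCM.CMField.K F))) (HodgeCM.CMField.K F)) ⧸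
          Literature.NumberTheory.Automorphic.relNormOneRat (↥(maximalRealSubfield (HodgeCM.CMField.K F))) (HodgeCM.CMField.K F)),
        (∀ u : UfZero (cDiag Φ ι₁ ((a : ↥(maximalRealSubfield (HodgeCM.CMField.K F))) : (HodgeCM.CMField.K F)) ha ha0).D,
          (distDatumAt V Φ ι₁ ((a : ↥(maximalRealSubfield (HodgeCM.CMField.K F))) : (HodgeCM.CMField.K F)) ha ha0 (1 : CMAdelic (HodgeCM.CMField.K F) (frameD V) × CMAdelic (HodgeCM.CMField.K F) (dW (cDiag Φ ι₁ ((a : ↥(maximalRealSubfield (HodgeCM.CMField.K F))) : (HodgeCM.CMField.K F)) ha ha0).D) →* ℂˣ) (one_apply_rat_eq_one V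
              (cDiag Φ ι₁ ((a : ↥(maximalRealSubfield (HodgeCM.CMField.K F))) : (HodgeCM.CMField.K F)) ha ha0)) (continuous_one_val V (cDiag Φ ι₁ ((a : ↥(maximalRealSubfield (HodgeCM.CMField.K F))) : (HodgeCM.CMField.K F)) ha ha0)) ((cmLineChar₀ (HodgeCM.CMField.K F) finProdFinEquiv e₁ (frameD V) (frameD_real V) (frameD_ne V)
              (dW (cDiag Φ ι₁ ((a : ↥(maximalRealSubfield (HodgeCM.CMField.K F))) : (HodgeCM.CMField.K F)) ha ha0).D) (dW_real (cDiag Φ ι₁ ((a : ↥(maximalRealSubfield (HodgeCM.CMField.K F))) : (HodgeCM.CMField.K F)) ha ha0).D) (dW_ne (cDiag Φ ι₁ ((a : ↥(maximalRealSubfield (HodgeCM.CMField.K F))) : (HodgeCM.CMField.K F)) ha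
              ha0).D) (compat_plane V Φ ι₁ ((a : ↥(maximalRealSubfield (HodgeCM.CMField.K F))) : (HodgeCM.CMField.K F)) ha ha0) (compat_line₀ V Φ ι₁ ((a : ↥(maximalRealSubfield (HodgeCM.CMField.K F))) : (HodgeCM.CMField.K F)) ha ha0) (compat_line₁ V Φ ι₁ ((a : ↥(maximalRealSubfield (HodgeCM.CMField.K F))) : (HodgeCM.CMField.K
              F)) ha ha0)).comp (MonoidHom.inl _ _) * (ĉ.comp (UnitaryGroup.adelicInl (↥(maximalRealSubfield (HodgeCM.CMField.K F))) (HodgeCM.CMField.K F) (IsCMField.complexConj (HodgeCM.CMField.K F)) 3 1 (Matrix.diagonal (frameD V)) (Matrix.diagonal (lineVec (HodgeCM.CMField.K F) ((a : ↥(maximalRealSubfield (HodgeCM.CMField.K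
              F))) : (HodgeCM.CMField.K F))))))⁻¹) hν hνc A hV (blockFamilyOfAt (HodgeCM.CMField.K F) e₁ (frameD V) (frameD_real V) (frameD_ne V) (lineVec (HodgeCM.CMField.K F) (dW (cDiag Φ ι₁ ((a : ↥(maximalRealSubfield (HodgeCM.CMField.K F))) : (HodgeCM.CMField.K F)) ha ha0).D 0)) (fun _ => dW_real (cDiag Φ ι₁ ((a :
              ↥(maximalRealSubfield (HodgeCM.CMField.K F))) : (HodgeCM.CMField.K F)) ha ha0).D 0) (fun _ => dW_ne (cDiag Φ ι₁ ((a : ↥(maximalRealSubfield (HodgeCM.CMField.K F))) : (HodgeCM.CMField.K F)) ha ha0).D 0) ι₁ (blockPosEquiv V) (blockNegEquiv V) (posIdxEquivUnit hpos) (negIdxEquivEmpty hpos) (degOnePDual Empty) (binvPi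
              1)) harm hdef).chiFin χM u = finCharZero V (cDiag Φ ι₁ ((a : ↥(maximalRealSubfield (HodgeCM.CMField.K F))) : (HodgeCM.CMField.K F)) ha ha0).D (compat_plane V Φ ι₁ ((a : ↥(maximalRealSubfield (HodgeCM.CMField.K F))) : (HodgeCM.CMField.K F)) ha ha0) (compat_line₀ V Φ ι₁ ((a : ↥(maximalRealSubfield (HodgeCM.CMField.K
              F))) : (HodgeCM.CMField.K F)) ha ha0) (compat_line₁ V Φ ι₁ ((a : ↥(maximalRealSubfield (HodgeCM.CMField.K F))) : (HodgeCM.CMField.K F)) ha ha0) (etaT₀ V (cDiag Φ ι₁ ((a : ↥(maximalRealSubfield (HodgeCM.CMField.K F))) : (HodgeCM.CMField.K F)) ha ha0).D (1 : CMAdelic (HodgeCM.CMField.K F) (frameD V) × CMAdelic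
              (HodgeCM.CMField.K F) (dW (cDiag Φ ι₁ ((a : ↥(maximalRealSubfield (HodgeCM.CMField.K F))) : (HodgeCM.CMField.K F)) ha ha0).D) →* ℂˣ) ((cmLineChar₀ (HodgeCM.CMField.K F) finProdFinEquiv e₁ (frameD V) (frameD_real V) (frameD_ne V) (dW (cDiag Φ ι₁ ((a : ↥(maximalRealSubfield (HodgeCM.CMField.K F))) :
              (HodgeCM.CMField.K F)) ha ha0).D) (dW_real (cDiag Φ ι₁ ((a : ↥(maximalRealSubfield (HodgeCM.CMField.K F))) : (HodgeCM.CMField.K F)) ha ha0).D) (dW_ne (cDiag Φ ι₁ ((a : ↥(maximalRealSubfield (HodgeCM.CMField.K F))) : (HodgeCM.CMField.K F)) ha ha0).D) (compat_plane V Φ ι₁ ((a : ↥(maximalRealSubfield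
              (HodgeCM.CMField.K F))) : (HodgeCM.CMField.K F)) ha ha0) (compat_line₀ V Φ ι₁ ((a : ↥(maximalRealSubfield (HodgeCM.CMField.K F))) : (HodgeCM.CMField.K F)) ha ha0) (compat_line₁ V Φ ι₁ ((a : ↥(maximalRealSubfield (HodgeCM.CMField.K F))) : (HodgeCM.CMField.K F)) ha ha0)).comp (MonoidHom.inl _ _) * (ĉ.comp
              (UnitaryGroup.adelicInl (↥(maximalRealSubfield (HodgeCM.CMField.K F))) (HodgeCM.CMField.K F) (IsCMField.complexConj (HodgeCM.CMField.K F)) 3 1 (Matrix.diagonal (frameD V)) (Matrix.diagonal (lineVec (HodgeCM.CMField.K F) ((a : ↥(maximalRealSubfield (HodgeCM.CMField.K F))) : (HodgeCM.CMField.K F))))))⁻¹)) (1, u) *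
              (((ĉ.comp ((MonoidHom.noncommCoprod (UnitaryGroup.adelicInl (↥(maximalRealSubfield (HodgeCM.CMField.K F))) (HodgeCM.CMField.K F) (IsCMField.complexConj (HodgeCM.CMField.K F)) 3 1 (Matrix.diagonal (frameD V)) (Matrix.diagonal (lineVec (HodgeCM.CMField.K F) ((a : ↥(maximalRealSubfield (HodgeCM.CMField.K F))) :
              (HodgeCM.CMField.K F))))) (UnitaryGroup.adelicInr (↥(maximalRealSubfield (HodgeCM.CMField.K F))) (HodgeCM.CMField.K F) (IsCMField.complexConj (HodgeCM.CMField.K F)) 3 1 (Matrix.diagonal (frameD V)) (Matrix.diagonal (lineVec (HodgeCM.CMField.K F) ((a : ↥(maximalRealSubfield (HodgeCM.CMField.K F))) :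
              (HodgeCM.CMField.K F))))) (UnitaryGroup.commute_adelicInl_adelicInr (↥(maximalRealSubfield (HodgeCM.CMField.K F))) (HodgeCM.CMField.K F) (IsCMField.complexConj (HodgeCM.CMField.K F)) 3 1 (Matrix.diagonal (frameD V)) (Matrix.diagonal (lineVec (HodgeCM.CMField.K F) ((a : ↥(maximalRealSubfield (HodgeCM.CMField.K F)))
              : (HodgeCM.CMField.K F)))))).comp (finPairToAdelic (↥(maximalRealSubfield (HodgeCM.CMField.K F))) (HodgeCM.CMField.K F) (IsCMField.complexConj (HodgeCM.CMField.K F)) 3 1 (Matrix.diagonal (frameD V)) (Matrix.diagonal (lineVec (HodgeCM.CMField.K F) ((a : ↥(maximalRealSubfield (HodgeCM.CMField.K F))) :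
              (HodgeCM.CMField.K F))))))).comp (MonoidHom.inr _ _))⁻¹ * ((lineChar (↥(maximalRealSubfield (HodgeCM.CMField.K F))) (HodgeCM.CMField.K F) (IsCMField.complexConj (HodgeCM.CMField.K F)) a t.χ.1).comp (MulEquiv.subgroupCongr (finAdelic_JW_eq (HodgeCM.CMField.K F) a)).symm.toMonoidHom)) u) ∧
        ∃ Φf : FinSB (↥(maximalRealSubfield (HodgeCM.CMField.K F))) (Fin 3), (distDatumAt V Φ ι₁ ((a : ↥(maximalRealSubfield (HodgeCM.CMField.K F))) : (HodgeCM.CMField.K F)) ha ha0 (1 : CMAdelic (HodgeCM.CMField.K F) (frameD V) × CMAdelic (HodgeCM.CMField.K F) (dW (cDiag Φ ι₁ ((a : ↥(maximalRealSubfield (HodgeCM.CMField.K F)))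
            : (HodgeCM.CMField.K F)) ha ha0).D) →* ℂˣ) (one_apply_rat_eq_one V (cDiag Φ ι₁ ((a : ↥(maximalRealSubfield (HodgeCM.CMField.K F))) : (HodgeCM.CMField.K F)) ha ha0)) (continuous_one_val V (cDiag Φ ι₁ ((a : ↥(maximalRealSubfield (HodgeCM.CMField.K F))) : (HodgeCM.CMField.K F)) ha ha0)) ((cmLineChar₀ (HodgeCM.CMField.K
            F) finProdFinEquiv e₁ (frameD V) (frameD_real V) (frameD_ne V) (dW (cDiag Φ ι₁ ((a : ↥(maximalRealSubfield (HodgeCM.CMField.K F))) : (HodgeCM.CMField.K F)) ha ha0).D) (dW_real (cDiag Φ ι₁ ((a : ↥(maximalRealSubfield (HodgeCM.CMField.K F))) : (HodgeCM.CMField.K F)) ha ha0).D) (dW_ne (cDiag Φ ι₁ ((a :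
            ↥(maximalRealSubfield (HodgeCM.CMField.K F))) : (HodgeCM.CMField.K F)) ha ha0).D) (compat_plane V Φ ι₁ ((a : ↥(maximalRealSubfield (HodgeCM.CMField.K F))) : (HodgeCM.CMField.K F)) ha ha0) (compat_line₀ V Φ ι₁ ((a : ↥(maximalRealSubfield (HodgeCM.CMField.K F))) : (HodgeCM.CMField.K F)) ha ha0) (compat_line₁ V Φ ι₁
            ((a : ↥(maximalRealSubfield (HodgeCM.CMField.K F))) : (HodgeCM.CMField.K F)) ha ha0)).comp (MonoidHom.inl _ _) * (ĉ.comp (UnitaryGroup.adelicInl (↥(maximalRealSubfield (HodgeCM.CMField.K F))) (HodgeCM.CMField.K F) (IsCMField.complexConj (HodgeCM.CMField.K F)) 3 1 (Matrix.diagonal (frameD V)) (Matrix.diagonal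
            (lineVec (HodgeCM.CMField.K F) ((a : ↥(maximalRealSubfield (HodgeCM.CMField.K F))) : (HodgeCM.CMField.K F))))))⁻¹) hν hνc A hV (blockFamilyOfAt (HodgeCM.CMField.K F) e₁ (frameD V) (frameD_real V) (frameD_ne V) (lineVec (HodgeCM.CMField.K F) (dW (cDiag Φ ι₁ ((a : ↥(maximalRealSubfield (HodgeCM.CMField.K F))) :
            (HodgeCM.CMField.K F)) ha ha0).D 0)) (fun _ => dW_real (cDiag Φ ι₁ ((a : ↥(maximalRealSubfield (HodgeCM.CMField.K F))) : (HodgeCM.CMField.K F)) ha ha0).D 0) (fun _ => dW_ne (cDiag Φ ι₁ ((a : ↥(maximalRealSubfield (HodgeCM.CMField.K F))) : (HodgeCM.CMField.K F)) ha ha0).D 0) ι₁ (blockPosEquiv V) (blockNegEquiv V)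
            (posIdxEquivUnit hpos) (negIdxEquivEmpty hpos) (degOnePDual Empty) (binvPi 1)) harm hdef).dist (charInv χM) Φf ≠ 0) :
    R →
  ∀ (hDel : Literature.AlgebraicGeometry.ShimuraVarieties.UnitaryCanonicalModel.canonicalModel_exists_printed)
      (F : HodgeCM.CMField) [IsGalois ℚ F] (h6 : 6 ≤ Module.finrank ℚ F) {ι₁ : F →+* ℂ} (V : HodgeCM.HermSpace3 F ι₁) (a₀ : RealScalar F)
      (Φ : CMType F) (hΦ : ι₁ ∈ Φ.1) (i : (I V (repAt a₀) (muLiu ι₁ GramClass.rep))),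
      (datum413 hDel F V a₀ Φ i).n = 3 →
        ∀ (t : (datum413 hDel F V a₀ Φ i).Triple), t.HasWeightOne → t.IsAdmissible → ι₁ ∈ t.cmType.1 →
          ∀ (e : HodgeCM.CMField.K F) (a : (↥(maximalRealSubfield (HodgeCM.CMField.K F)))ˣ),
            Literature.AlgebraicGeometry.Liu2021.IsAdmissibleElement (HodgeCM.CMField.K F) t.cmType.1 e →
            locF ↥(maximalRealSubfield (HodgeCM.CMField.K F)) (imagUnitSq (HodgeCM.CMField.K F)) a = t.ε →
            ((a : ↥(maximalRealSubfield (HodgeCM.CMField.K F))) : HodgeCM.CMField.K F) = e * (2 * imagUnit (HodgeCM.CMField.K F)) →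
              ∃ θ : Def411WeilCarriers.omegaAtLine ↥(maximalRealSubfield (HodgeCM.CMField.K F)) (HodgeCM.CMField.K F)
                    (IsCMField.complexConj (HodgeCM.CMField.K F)) 3 e₁ (Matrix.diagonal (frameD V)) (complexConj_imagUnit (HodgeCM.CMField.K F))
                    (imagUnit_ne_zero (HodgeCM.CMField.K F)) (imagUnit_mul_self (HodgeCM.CMField.K F))
                    (realDiagonal_isSymm (HodgeCM.CMField.K F) (frameD V) (frameD_real V))
                    (isUnit_det_realDiagonal (HodgeCM.CMField.K F) (frameD V) (frameD_real V) (frameD_ne V))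
                    (realDiagonal_map (HodgeCM.CMField.K F) (frameD V) (frameD_real V)).symm
                    (OmegaChiSplitting.hsChiD ⟨HodgeCM.CMField.K F⟩ e₁ (frameD V) (frameD_real V) (frameD_ne V)
                      (Literature.NumberTheory.Automorphic.IdeleClassGroup.toHeckeCharacter (HodgeCM.CMField.K F) t.μ)
                      (Literature.NumberTheory.Automorphic.IdeleClassGroup.isUnitary_toHeckeCharacter (HodgeCM.CMField.K F) t.μ)
                      ((Literature.RepresentationTheory.Liu2021.isOscillatorChar_toHeckeCharacter_iff t.μ).mpr t.isConjugateSymplectic))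
                    a t.χ →ₗ[ℂ] ((adelicDatum F V).Adelic → (Fin 2 → ℂ)),
                θ ≠ 0 ∧ (∀ w, θ w ∈ holCotForms (archFactorOf F V)) ∧
                  ∀ (g : ↥(HodgeCM.HermSpace3.adelicFin V))
                    (w : Def411WeilCarriers.omegaAtLine ↥(maximalRealSubfield (HodgeCM.CMField.K F)) (HodgeCM.CMField.K F)
                    (IsCMField.complexConj (HodgeCM.CMField.K F)) 3 e₁ (Matrix.diagonal (frameD V)) (complexConj_imagUnit (HodgeCM.CMField.K F))
                    (imagUnit_ne_zero (HodgeCM.CMField.K F)) (imagUnit_mul_self (HodgeCM.CMField.K F))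
                    (realDiagonal_isSymm (HodgeCM.CMField.K F) (frameD V) (frameD_real V))
                    (isUnit_det_realDiagonal (HodgeCM.CMField.K F) (frameD V) (frameD_real V) (frameD_ne V))
                    (realDiagonal_map (HodgeCM.CMField.K F) (frameD V) (frameD_real V)).symm
                    (OmegaChiSplitting.hsChiD ⟨HodgeCM.CMField.K F⟩ e₁ (frameD V) (frameD_real V) (frameD_ne V)
                      (Literature.NumberTheory.Automorphic.IdeleClassGroup.toHeckeCharacter (HodgeCM.CMField.K F) t.μ)
                      (Literature.NumberTheory.Automorphic.IdeleClassGroup.isUnitary_toHeckeCharacter (HodgeCM.CMField.K F) t.μ)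
                      ((Literature.RepresentationTheory.Liu2021.isOscillatorChar_toHeckeCharacter_iff t.μ).mpr t.isConjugateSymplectic))
                    a t.χ),
                    θ (Def411WeilCarriers.rhoVAtLine ↥(maximalRealSubfield (HodgeCM.CMField.K F)) (HodgeCM.CMField.K F)
                      (IsCMField.complexConj (HodgeCM.CMField.K F)) 3 e₁ (Matrix.diagonal (frameD V)) (complexConj_imagUnit (HodgeCM.CMField.K F))
                      (imagUnit_ne_zero (HodgeCM.CMField.K F)) (imagUnit_mul_self (HodgeCM.CMField.K F))
                      (realDiagonal_isSymm (HodgeCM.CMField.K F) (frameD V) (frameD_real V))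
                      (isUnit_det_realDiagonal (HodgeCM.CMField.K F) (frameD V) (frameD_real V) (frameD_ne V))
                      (realDiagonal_map (HodgeCM.CMField.K F) (frameD V) (frameD_real V)).symm
                      (OmegaChiSplitting.hsChiD ⟨HodgeCM.CMField.K F⟩ e₁ (frameD V) (frameD_real V) (frameD_ne V)
                        (Literature.NumberTheory.Automorphic.IdeleClassGroup.toHeckeCharacter (HodgeCM.CMField.K F) t.μ)
                        (Literature.NumberTheory.Automorphic.IdeleClassGroup.isUnitary_toHeckeCharacter (HodgeCM.CMField.K F) t.μ)
                        ((Literature.RepresentationTheory.Liu2021.isOscillatorChar_toHeckeCharacter_iff t.μ).mpr t.isConjugateSymplectic))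
                      a t.χ (ιVE V g) w) = rightRep F V g (θ w)
 :=
  fun hR hDel F _ h6 _ V a₀ Φ _ i _ t hw _ hι e a he _ hae =>
    exists_holTheta_admissibleLine_of_chiN hDel F h6 V a₀ Φ i t hw hι e a he hae (chiN hR hDel F h6 V a₀ Φ i t hw hι e a he hae)

end Summit.HodgeConjecture.HodgeConjecture.Cruxes.H413.ThetaJunction

end
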